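import Summits.Ventures.PercRepro2.CaseOneReductions

/-!
# What an irreducible instance looks like (blind cell PercRepro2, p1 g29; the reading of
`Irreducible` of `CaseOneReductions`)

An irreducible instance of the rung is residual in the sense of `CaseOneResidual` (no unmarked leaf,
no parallel pair, no unmarked series vertex, no loop: `Irreducible.residual`), its statement vertex is
not an unmarked leaf (`Irreducible.not_leaf_a3`), and neither `o` nor `b` is a leaf unless it
coincides with another mark (`Irreducible.not_leaf_o`, `Irreducible.not_leaf_b`). Conversely these
four conditions are all that `Irreducible` says (`irreducible_iff`). Own code; standard axioms.
-/

namespace Summit.Ventures.PercRepro2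

namespace CaseOne

universe u

section Irr
variable {V : Type*} {E : Type u} [Fintype E] [DecidableEq E] {ends : E → Sym2 V}
  {o a₁ a₂ a₃ b : V}

/-- An irreducible instance is residual: no thickening step applies at the statement vertex. -/
theorem Irreducible.residual (h : Irreducible o a₁ a₂ a₃ b E ends) :
    Residual o a₁ a₂ b a₃ E ends := by
  rintro ⟨E', _, _, ends', hstep⟩
  exact h ⟨o, a₁, a₂, a₃, b, E', _, _, ends', RedStep.thick hstep⟩

/-- In an irreducible instance an unmarked statement vertex is not a leaf. -/
theorem Irreducible.not_leaf_a3 (h : Irreducible o a₁ a₂ a₃ b E ends) {x : V} {e₀ : E}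
    (hl : IsLeafAt ends x a₃ e₀) (ho : o ≠ a₃) (h1 : a₁ ≠ a₃) (h2 : a₂ ≠ a₃) (hb : b ≠ a₃) :
    False :=
  h ⟨o, a₁, a₂, x, b, {e : E // e ≠ e₀}, _, _, restrictEnds ends e₀,
    RedStep.leafMove E ends x a₃ e₀ hl ho h1 h2 hb⟩

/-- In an irreducible instance the mark `o` is not a leaf unless it coincides with another mark. -/
theorem Irreducible.not_leaf_o (h : Irreducible o a₁ a₂ a₃ b E ends) {y : V} {e₀ : E}
    (hl : IsLeafAt ends y o e₀) (h1 : a₁ ≠ o) (h2 : a₂ ≠ o) (h3 : a₃ ≠ o) (hb : b ≠ o) : False :=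
  h ⟨y, a₁, a₂, a₃, b, {e : E // e ≠ e₀}, _, _, restrictEnds ends e₀,
    RedStep.oMove E ends y o e₀ hl h1 h2 h3 hb⟩

/-- In an irreducible instance the mark `b` is not a leaf unless it coincides with another mark. -/
theorem Irreducible.not_leaf_b (h : Irreducible o a₁ a₂ a₃ b E ends) {y : V} {e₀ : E}
    (hl : IsLeafAt ends y b e₀) (ho : o ≠ b) (h1 : a₁ ≠ b) (h2 : a₂ ≠ b) (h3 : a₃ ≠ b) : False :=
  h ⟨o, a₁, a₂, a₃, y, {e : E // e ≠ e₀}, _, _, restrictEnds ends e₀,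
    RedStep.bMove E ends y b e₀ hl ho h1 h2 h3⟩

/-- **The reading of `Irreducible`**: residual, the statement vertex not an unmarked leaf, `o` and `b`
not leaves (unless coincident with another mark). -/
theorem irreducible_iff :
    Irreducible o a₁ a₂ a₃ b E ends ↔
      Residual o a₁ a₂ b a₃ E ends ∧
      (∀ (x : V) (e₀ : E), IsLeafAt ends x a₃ e₀ → o ≠ a₃ → a₁ ≠ a₃ → a₂ ≠ a₃ → b ≠ a₃ → False) ∧
      (∀ (y : V) (e₀ : E), IsLeafAt ends y o e₀ → a₁ ≠ o → a₂ ≠ o → a₃ ≠ o → b ≠ o → False) ∧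
      (∀ (y : V) (e₀ : E), IsLeafAt ends y b e₀ → o ≠ b → a₁ ≠ b → a₂ ≠ b → a₃ ≠ b → False) := by
  constructor
  · intro h
    exact ⟨h.residual, fun x e₀ hl ho h1 h2 hb => h.not_leaf_a3 hl ho h1 h2 hb,
      fun y e₀ hl h1 h2 h3 hb => h.not_leaf_o hl h1 h2 h3 hb,
      fun y e₀ hl ho h1 h2 h3 => h.not_leaf_b hl ho h1 h2 h3⟩
  · rintro ⟨hres, ha, ho, hb⟩ ⟨o', a₁', a₂', a₃', b', E', _, _, ends', hstep⟩
    cases hstep with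
    | thick hth => exact hres ⟨E', _, _, ends', hth⟩
    | leafMove _ _ _ _ _ hl ho' h1 h2 hb' => exact ha _ _ hl ho' h1 h2 hb'
    | oMove _ _ _ _ _ hl h1 h2 h3 hb' => exact ho _ _ hl h1 h2 h3 hb'
    | bMove _ _ _ _ _ hl ho' h1 h2 h3 => exact hb _ _ hl ho' h1 h2 h3

end Irr

end CaseOne

end Summit.Ventures.PercRepro2
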